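import Literature.Analysis.FluidPDE.ScalarFourierFamily
import HarnessLib

/-!
# Picard iteration for the Fourier-transformed forced advection–diffusion equation on `T^d`

Analysis/FluidPDE proof file, fifth of the files discharging
`Literature.Analysis.FluidPDE.Torus.exists_unique_isClassicalScalarTransportForcedOn`
(objects in `ScalarFourierDefs`, estimates in `ScalarFourierFamily`). For Fourier-side data
`(κ, T, U, S, a)` under `PicardHyp` (diffusivity `κ > 0`, drift coefficients `Uⱼ(t)`, source
coefficients `S(t)`, datum `a`, all with every polynomial decay, continuous in time) the mild
(Duhamel) form of `∂ₜc = -νₖ c + S - N(U, c)`, `νₖ = 4π²κ|k|²`, is the fixed-point equation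

  `c(t,k) = e^{-νₖτ} a(k) + ∫₀^τ e^{-νₖ(τ-s)} (S(s,k) - N(U(s), c(s))(k)) ds`,  `τ = clamp T t`,

solved by Picard iteration `c₀ = 0`, `cₙ₊₁ = Φ(cₙ)` (`picardIter`) with all estimates explicit
in the weighted sup-norms `sup e^{-λ clamp t} (1+‖k‖)^K ‖c(t,k)‖` (the torus twin of
`NSFourierPicard`; Lemarié-Rieusset 2016, §8.5, for the weighted-`L^∞` / pseudo-measure method;
Leray 1934, §19, for successive approximations). The equation being linear, the map is a
contraction on all of `[0, T]` once the time weight `λ` is large: the transport symbol loses one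
derivative and the heat factor regains it,
`(1 + ‖k‖) ∫₀^τ e^{-νₖ(τ-s)} e^{λs} ds ≤ e^{λτ}(1 + 1/(2√(4π²κ)))/√λ` (`heat_weight_gain`, from the
tree's `FourierNS.heatGain_le`).

* `PicardHyp.hasDecay_picardMap_sub` — the Lipschitz estimate of `Φ` in the weighted norm;
  `PicardHyp.exists_contraction` — a weight `λ_K` with factor `1/2` for every order `K`;
* `PicardHyp.iter_estimates`, `PicardHyp.iter_tendsto` — continuity of the iterates, geometric
  convergence with every polynomial decay uniformly in time;
* the limit `c = picardLim`: continuous in time (`continuous_picardLim`), every decay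
  (`hasDecay_picardLim`), the mild equation `c = Φ(c)` (`picardLim_eq_picardMap`) and the datum
  `c(0) = a` (`picardLim_zero`).

## Mathlib search

`cauchySeq_of_le_geometric`, `dist_le_of_le_geometric_of_tendsto`, `CauchySeq.tendsto_limUnder`,
`TendstoUniformly.continuous`, `intervalIntegral.continuous_parametric_intervalIntegral_of_continuous`,
`intervalIntegral.norm_integral_le_of_norm_le`, `tendsto_pow_atTop_nhds_zero_of_lt_one`.
Mathlib has no heat semigroup / mild parabolic iteration (searched `Duhamel`, `mild`).

## References

* N. V. Krylov, *Lectures on Elliptic and Parabolic Equations in Hölder Spaces*, AMS 1996,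
  Thm. 9.2.3. [Krylov1996]
* P. G. Lemarié-Rieusset, *The Navier–Stokes problem in the 21st century*, CRC 2016, §8.5.
* J. Leray, Acta Math. 63 (1934), §19. [Leray1934]
-/

noncomputable section

namespace Literature.Analysis.FluidPDE

namespace ScalarFourier

open MeasureTheory Real Set Filter UnitAddTorus intervalIntegral
open scoped Topology
open FourierNS (HasDecay clamp)
open Literature.Analysis.FunctionSpaces.Torus (freqNormSq latticeVec)

variable {d : Type*} [Fintype d]

/-! ### The heat factor -/

section Heat

variable {κ : ℝ}

/-- `νₖ ≥ 0` for `κ ≥ 0`. [folklore] -/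
theorem heatRate_nonneg (hκ : 0 ≤ κ) (k : d → ℤ) : 0 ≤ heatRate κ k := by
  rw [heatRate_apply]
  have := FunctionSpaces.Torus.freqNormSq_nonneg k
  positivity

/-- `0 < e^{-νₖt}`. [folklore] -/
theorem heatFactor_pos (κ : ℝ) (k : d → ℤ) (t : ℝ) : 0 < heatFactor κ k t := Real.exp_pos _

/-- `e^{-νₖt} ≤ 1` for `κ, t ≥ 0`. [folklore] -/
theorem heatFactor_le_one (hκ : 0 ≤ κ) (k : d → ℤ) {t : ℝ} (ht : 0 ≤ t) : heatFactor κ k t ≤ 1 := by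
  rw [heatFactor_apply, Real.exp_le_one_iff, neg_nonpos]
  exact mul_nonneg (heatRate_nonneg hκ k) ht

/-- `‖(e^{-νₖt} : ℂ)‖ = e^{-νₖt}`. [folklore] -/
theorem norm_heatFactor (κ : ℝ) (k : d → ℤ) (t : ℝ) :
    ‖(heatFactor κ k t : ℂ)‖ = heatFactor κ k t := by
  rw [Complex.norm_real, Real.norm_of_nonneg (heatFactor_pos κ k t).le]

/-- The heat rate in Euclidean form: `νₖ = (4π²κ) ‖latticeVec k‖²`. [folklore] -/
theorem heatRate_eq [DecidableEq d] (κ : ℝ) (k : d → ℤ) :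
    heatRate κ k = 4 * π ^ 2 * κ * ‖latticeVec k‖ ^ 2 := by
  rw [heatRate_apply, freqNormSq_eq_norm_latticeVec_sq]

/-- Continuity of `(τ, s) ↦ e^{-νₖ(τ - s)}` composed with continuous maps. [folklore] -/
theorem continuous_heatFactor_comp {X : Type*} [TopologicalSpace X] {f : X → ℝ}
    (hf : Continuous f) (κ : ℝ) (k : d → ℤ) : Continuous fun x => (heatFactor κ k (f x) : ℂ) := by
  simp only [heatFactor_apply]
  fun_prop

/-- **Heat gain on the lattice.** For `κ > 0`, `λ ≥ 1`, `τ ≥ 0`: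
`(1 + ‖k‖) ∫₀^τ e^{-νₖ(τ-s)} e^{λs} ds ≤ e^{λτ} (1 + 1/(2√(4π²κ))) / √λ` — the heat factor
recovers the derivative lost in the transport term, uniformly in the frequency, at the price
`λ^{-1/2}` in the exponential time weight (tree `FourierNS.heatGain_le`, with
`‖k‖ ≤ ‖latticeVec k‖` and `νₖ = 4π²κ ‖latticeVec k‖²`). [folklore] -/
theorem heat_weight_gain [DecidableEq d] (hκ : 0 < κ) {lam : ℝ} (hlam : 1 ≤ lam) (k : d → ℤ)
    {τ : ℝ} (hτ : 0 ≤ τ) :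
    (1 + ‖k‖) * ∫ s in (0 : ℝ)..τ, Real.exp (-(heatRate κ k) * (τ - s)) * Real.exp (lam * s) ≤
      Real.exp (lam * τ) * ((1 + 1 / (2 * Real.sqrt (4 * π ^ 2 * κ))) / Real.sqrt lam) := by
  have hlam0 : 0 < lam := by linarith
  have hc : 0 < 4 * π ^ 2 * κ := by positivity
  set r := ‖latticeVec k‖ with hr
  have hr0 : 0 ≤ r := norm_nonneg _
  have hν : heatRate κ k = 4 * π ^ 2 * κ * r ^ 2 := heatRate_eq κ k
  set J := ∫ s in (0 : ℝ)..τ, Real.exp (-(heatRate κ k) * (τ - s)) * Real.exp (lam * s) with hJ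
  -- the two pieces
  have h1 : J ≤ Real.exp (lam * τ) / lam := by
    have h := FourierNS.integral_exp_neg_mul_sub_mul_exp_le (β := heatRate κ k) (t := τ)
      (heatRate_nonneg hκ.le k) hlam0
    refine h.trans ?_
    exact div_le_div_of_nonneg_left (Real.exp_pos _).le hlam0
      (le_add_of_nonneg_left (heatRate_nonneg hκ.le k))
  have h2 : r * J ≤ Real.exp (lam * τ) / (2 * Real.sqrt (4 * π ^ 2 * κ * lam)) := by
    have h := FourierNS.heatGain_le (t := τ) hc hlam0 hr0
    rw [← hν] at h
    exact h
  have hJ0 : 0 ≤ J := intervalIntegral.integral_nonneg hτ fun s _ => by positivity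
  have hsl : 0 < Real.sqrt lam := Real.sqrt_pos.2 hlam0
  have hsq : Real.sqrt lam ≤ lam := by
    have h1 : 1 ≤ Real.sqrt lam := Real.one_le_sqrt.2 hlam
    calc Real.sqrt lam = Real.sqrt lam * 1 := (mul_one _).symm
      _ ≤ Real.sqrt lam * Real.sqrt lam := mul_le_mul_of_nonneg_left h1 hsl.le
      _ = lam := Real.mul_self_sqrt hlam0.le
  have h1' : Real.exp (lam * τ) / lam ≤ Real.exp (lam * τ) / Real.sqrt lam :=
    div_le_div_of_nonneg_left (Real.exp_pos _).le hsl hsq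
  have hsc : 0 < Real.sqrt (4 * π ^ 2 * κ) := Real.sqrt_pos.2 hc
  have hprod : Real.sqrt (4 * π ^ 2 * κ * lam) = Real.sqrt (4 * π ^ 2 * κ) * Real.sqrt lam :=
    Real.sqrt_mul hc.le lam
  calc (1 + ‖k‖) * J = J + ‖k‖ * J := by ring
    _ ≤ J + r * J := by gcongr; exact norm_le_norm_latticeVec k
    _ ≤ Real.exp (lam * τ) / lam + Real.exp (lam * τ) / (2 * Real.sqrt (4 * π ^ 2 * κ * lam)) :=
        add_le_add h1 h2
    _ ≤ Real.exp (lam * τ) / Real.sqrt lam +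
        Real.exp (lam * τ) / (2 * Real.sqrt (4 * π ^ 2 * κ * lam)) := add_le_add h1' le_rfl
    _ = Real.exp (lam * τ) * ((1 + 1 / (2 * Real.sqrt (4 * π ^ 2 * κ))) / Real.sqrt lam) := by
        rw [hprod]
        field_simp

end Heat

/-! ### The Duhamel map: continuity and the two basic bounds -/

section Duhamel

variable {κ T : ℝ} {U : d → ℝ → (d → ℤ) → ℂ} {S : ℝ → (d → ℤ) → ℂ} {a : (d → ℤ) → ℂ}

/-- Norm of a Duhamel integral `∫₀^τ e^{-νₖ(τ-s)} F(s) ds` over `[0, τ]` for a continuous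
integrand bounded by `M e^{λs}`: at most `M ∫₀^τ e^{-νₖ(τ-s)} e^{λs} ds`. [folklore] -/
theorem norm_duhamel_le (κ : ℝ) {τ : ℝ} (hτ : 0 ≤ τ) {F : ℝ → ℂ}
    {M lam : ℝ} (hbound : ∀ s ∈ Icc 0 τ, ‖F s‖ ≤ M * Real.exp (lam * s)) (k : d → ℤ) :
    ‖∫ s in (0 : ℝ)..τ, (heatFactor κ k (τ - s) : ℂ) * F s‖ ≤
      M * ∫ s in (0 : ℝ)..τ, Real.exp (-(heatRate κ k) * (τ - s)) * Real.exp (lam * s) := by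
  set g : ℝ → ℝ := fun s => Real.exp (-(heatRate κ k) * (τ - s)) * (M * Real.exp (lam * s)) with hg
  have hgc : Continuous g := by simp only [hg]; fun_prop
  have h1 : ‖∫ s in (0 : ℝ)..τ, (heatFactor κ k (τ - s) : ℂ) * F s‖ ≤ ∫ s in (0 : ℝ)..τ, g s := by
    refine intervalIntegral.norm_integral_le_of_norm_le hτ (Eventually.of_forall fun s hs => ?_)
      (hgc.intervalIntegrable _ _)
    rw [norm_mul, norm_heatFactor, heatFactor_apply]
    simp only [hg, neg_mul]
    exact mul_le_mul_of_nonneg_left (hbound s ⟨hs.1.le, hs.2⟩) (Real.exp_pos _).le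
  refine h1.trans_eq ?_
  rw [← intervalIntegral.integral_const_mul]
  refine intervalIntegral.integral_congr fun s _ => ?_
  simp only [hg]
  ring

/-- Norm of a Duhamel integral over `[0, τ]`, `0 ≤ τ ≤ T`, for an integrand bounded by `M`:
at most `T M` (the heat factor is at most one). [folklore] -/
theorem norm_duhamel_le_const (hκ : 0 ≤ κ) {τ : ℝ} (hτ : τ ∈ Icc 0 T) {F : ℝ → ℂ} {M : ℝ}
    (hM : 0 ≤ M) (hbound : ∀ s ∈ Icc 0 τ, ‖F s‖ ≤ M) (k : d → ℤ) :
    ‖∫ s in (0 : ℝ)..τ, (heatFactor κ k (τ - s) : ℂ) * F s‖ ≤ T * M := by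
  have h1 : ‖∫ s in (0 : ℝ)..τ, (heatFactor κ k (τ - s) : ℂ) * F s‖ ≤ M * |τ - 0| := by
    refine intervalIntegral.norm_integral_le_of_norm_le_const fun s hs => ?_
    rw [uIoc_of_le hτ.1] at hs
    rw [norm_mul, norm_heatFactor]
    calc heatFactor κ k (τ - s) * ‖F s‖ ≤ 1 * M :=
          mul_le_mul (heatFactor_le_one hκ k (by linarith [hs.2])) (hbound s ⟨hs.1.le, hs.2⟩)
            (norm_nonneg _) zero_le_one
      _ = M := one_mul M
  rw [sub_zero, abs_of_nonneg hτ.1] at h1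
  calc _ ≤ M * τ := h1
    _ ≤ M * T := mul_le_mul_of_nonneg_left hτ.2 hM
    _ = T * M := mul_comm _ _

/-- The transport symbol of a continuous, uniformly decaying coefficient field is continuous in
time at each frequency. [folklore] -/
theorem PicardHyp.continuous_transportSym (h : PicardHyp κ T U S a) {c : ℝ → (d → ℤ) → ℂ}
    {X : ℝ} (hc : ∀ m, Continuous fun t => c t m) (hcd : ∀ t, HasDecay (latOrder d + 1) X (c t))
    (k : d → ℤ) : Continuous fun s => transportSym (fun j => U j s) (c s) k := by
  obtain ⟨A, hA⟩ := h.decayU (latOrder d)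
  exact continuous_transportSym_param (U := fun s j => U j s) (fun j m => h.contU j m) hc
    (fun s j => hA j s) hcd k

/-- The Duhamel integrand `s ↦ e^{-νₖ(τ-s)} (S(s,k) - N(U(s), c(s))(k))` is continuous. [folklore] -/
theorem PicardHyp.continuous_integrand (h : PicardHyp κ T U S a) {c : ℝ → (d → ℤ) → ℂ}
    {X : ℝ} (hc : ∀ m, Continuous fun t => c t m) (hcd : ∀ t, HasDecay (latOrder d + 1) X (c t))
    (k : d → ℤ) (τ : ℝ) :
    Continuous fun s => (heatFactor κ k (τ - s) : ℂ) *
      (S s k - transportSym (fun j => U j s) (c s) k) :=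
  (continuous_heatFactor_comp (continuous_const.sub continuous_id) κ k).mul
    ((h.contS k).sub (h.continuous_transportSym hc hcd k))

/-- **Continuity of the Duhamel map in time**: `t ↦ Φ(c)(t, k)` is continuous when `c` is
continuous in time with uniform decay of order `2#d + 1` (parametric interval integrals,
Mathlib `intervalIntegral.continuous_parametric_intervalIntegral_of_continuous`). [folklore] -/
theorem PicardHyp.continuous_picardMap (h : PicardHyp κ T U S a) {c : ℝ → (d → ℤ) → ℂ}
    {X : ℝ} (hc : ∀ m, Continuous fun t => c t m) (hcd : ∀ t, HasDecay (latOrder d + 1) X (c t))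
    (k : d → ℤ) : Continuous fun t => picardMap κ T U S a c t k := by
  have h1 : Continuous fun t => (heatFactor κ k (clamp T t) : ℂ) * a k :=
    (continuous_heatFactor_comp (FourierNS.continuous_clamp T) κ k).mul continuous_const
  have hF : Continuous (Function.uncurry fun (t s : ℝ) => (heatFactor κ k (clamp T t - s) : ℂ) *
      (S s k - transportSym (fun j => U j s) (c s) k)) := by
    have hcl : Continuous fun p : ℝ × ℝ => clamp T p.1 - p.2 :=
      ((FourierNS.continuous_clamp T).comp continuous_fst).sub continuous_snd
    exact (continuous_heatFactor_comp hcl κ k).mul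
      (((h.contS k).sub (h.continuous_transportSym hc hcd k)).comp continuous_snd)
  have h2 := intervalIntegral.continuous_parametric_intervalIntegral_of_continuous (μ := volume)
    (a₀ := 0) hF (FourierNS.continuous_clamp T)
  exact h1.add h2

/-- The transport symbol of the zero field vanishes. [folklore] -/
@[simp]
theorem transportSym_zero (U : d → (d → ℤ) → ℂ) (k : d → ℤ) :
    transportSym U (fun _ => 0) k = 0 := by
  simp [transportSym_apply]

/-- **The first iterate** `c₁ = Φ(0)`: `c₁(t,k) = e^{-νₖτ} a(k) + ∫₀^τ e^{-νₖ(τ-s)} S(s,k) ds`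
is continuous in time and decays to order `K` with constant `Aₐ + T·B` (`Aₐ`, `B` the order-`K`
constants of the datum and of the source). [folklore] -/
theorem PicardHyp.hasDecay_picardMap_zero (h : PicardHyp κ T U S a) {K : ℕ} {Aₐ B : ℝ}
    (ha : HasDecay K Aₐ a) (hB : ∀ t, HasDecay K B (S t)) (t : ℝ) :
    HasDecay K (Aₐ + T * B) (picardMap κ T U S a (fun _ _ => 0) t) := by
  intro k
  have hτ := FourierNS.clamp_mem_Icc h.hT.le t
  set τ := clamp T t with hτdef
  have hB0 : 0 ≤ B := (hB 0).nonneg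
  have hw : 0 < ((1 + ‖k‖) ^ K)⁻¹ := by positivity
  have h0 : picardMap κ T U S a (fun _ _ => 0) t k =
      (heatFactor κ k τ : ℂ) * a k + ∫ s in (0 : ℝ)..τ, (heatFactor κ k (τ - s) : ℂ) * S s k := by
    simp only [picardMap, transportSym_zero, sub_zero, hτdef]
  rw [h0]
  have h1 : ‖(heatFactor κ k τ : ℂ) * a k‖ ≤ Aₐ * ((1 + ‖k‖) ^ K)⁻¹ := by
    rw [norm_mul, norm_heatFactor]
    calc heatFactor κ k τ * ‖a k‖ ≤ 1 * ‖a k‖ :=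
          mul_le_mul_of_nonneg_right (heatFactor_le_one h.hκ.le k hτ.1) (norm_nonneg _)
      _ ≤ Aₐ * ((1 + ‖k‖) ^ K)⁻¹ := by rw [one_mul]; exact ha k
  have h2 : ‖∫ s in (0 : ℝ)..τ, (heatFactor κ k (τ - s) : ℂ) * S s k‖ ≤
      T * (B * ((1 + ‖k‖) ^ K)⁻¹) :=
    norm_duhamel_le_const h.hκ.le hτ (by positivity) (fun s _ => hB s k) k
  calc ‖(heatFactor κ k τ : ℂ) * a k + ∫ s in (0 : ℝ)..τ, (heatFactor κ k (τ - s) : ℂ) * S s k‖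
      ≤ Aₐ * ((1 + ‖k‖) ^ K)⁻¹ + T * (B * ((1 + ‖k‖) ^ K)⁻¹) := norm_add_le_of_le h1 h2
    _ = (Aₐ + T * B) * ((1 + ‖k‖) ^ K)⁻¹ := by ring

/-- The first iterate is continuous in time at each frequency. [folklore] -/
theorem PicardHyp.continuous_picardMap_zero (h : PicardHyp κ T U S a) (k : d → ℤ) :
    Continuous fun t => picardMap κ T U S a (fun _ _ => 0) t k :=
  h.continuous_picardMap (X := 0) (fun _ => continuous_const) (fun _ => HasDecay.zero _) k

end Duhamel

/-! ### The contraction estimate in weighted sup-norms -/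

section Contraction

variable [DecidableEq d]
variable {κ T : ℝ} {U : d → ℝ → (d → ℤ) → ℂ} {S : ℝ → (d → ℤ) → ℂ} {a : (d → ℤ) → ℂ}

omit [DecidableEq d] in
/-- Nonnegative uniform decay constants of the drift coefficients. [folklore] -/
theorem PicardHyp.decayU_nonneg (h : PicardHyp κ T U S a) (K : ℕ) :
    ∃ A : ℝ, 0 ≤ A ∧ ∀ j t, HasDecay K A (U j t) := by
  obtain ⟨A, hA⟩ := h.decayU K
  exact ⟨max A 0, le_max_right _ _, fun j t => (hA j t).mono (le_max_left _ _)⟩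

omit [DecidableEq d] in
/-- Nonnegative uniform decay constants of the source coefficients. [folklore] -/
theorem PicardHyp.decayS_nonneg (h : PicardHyp κ T U S a) (K : ℕ) :
    ∃ B : ℝ, 0 ≤ B ∧ ∀ t, HasDecay K B (S t) := by
  obtain ⟨B, hB⟩ := h.decayS K
  exact ⟨max B 0, le_max_right _ _, fun t => (hB t).mono (le_max_left _ _)⟩

omit [DecidableEq d] in
/-- Nonnegative decay constants of the datum. [folklore] -/
theorem PicardHyp.decayA_nonneg (h : PicardHyp κ T U S a) (K : ℕ) :
    ∃ A₀ : ℝ, 0 ≤ A₀ ∧ HasDecay K A₀ a := by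
  obtain ⟨A₀, hA₀⟩ := h.decayA K
  exact ⟨max A₀ 0, le_max_right _ _, hA₀.mono (le_max_left _ _)⟩

omit [DecidableEq d] in
/-- The transport constant of order `K`, `#d · 2^K · latMass · 2π (A + A₀)`, is nonnegative. [folklore] -/
theorem transportConst_nonneg (K : ℕ) {A₀ A : ℝ} (hA₀ : 0 ≤ A₀) (hA : 0 ≤ A) :
    0 ≤ Fintype.card d * (2 ^ K * latMass d * (2 * π * (A + A₀))) := by
  have := latMass_nonneg (d := d)
  positivity

/-- **Lipschitz estimate of the Duhamel map in the weighted sup-norm.** Let the drift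
coefficients decay to orders `2#d` (constant `A₀`) and `K` (constant `A`), `K ≥ 2#d`, and let
`c₁`, `c₂` be continuous in time with uniform decay of order `2#d + 1`. If
`‖c₁(t,m) - c₂(t,m)‖ ≤ D e^{λ clamp t} (1+‖m‖)^{-(K+1)}` for all `t`, `m` (`λ ≥ 1`), then
`‖Φ(c₁)(t,k) - Φ(c₂)(t,k)‖ ≤ C_K · E(κ)/√λ · D e^{λ clamp t} (1+‖k‖)^{-(K+1)}` with
`C_K = #d 2^K latMass 2π(A + A₀)` and `E(κ) = 1 + 1/(2√(4π²κ))`: the map is affine in `c`,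
the transport symbol loses one order (`hasDecay_transportSym`) and the heat factor regains it
at the price `λ^{-1/2}` (`heat_weight_gain`) — the Fourier-side form of the parabolic
smoothing estimate (Lemarié-Rieusset 2016, §8.5, for the Navier–Stokes twin). [folklore] -/
theorem PicardHyp.hasDecay_picardMap_sub (h : PicardHyp κ T U S a) {K : ℕ} (hK : latOrder d ≤ K)
    {A₀ A : ℝ} (hA₀ : 0 ≤ A₀) (hA : 0 ≤ A) (hU₀ : ∀ j t, HasDecay (latOrder d) A₀ (U j t))
    (hUK : ∀ j t, HasDecay K A (U j t)) {c₁ c₂ : ℝ → (d → ℤ) → ℂ}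
    (hc₁ : ∀ m, Continuous fun t => c₁ t m) (hc₂ : ∀ m, Continuous fun t => c₂ t m) {X₁ X₂ : ℝ}
    (hd₁ : ∀ t, HasDecay (latOrder d + 1) X₁ (c₁ t)) (hd₂ : ∀ t, HasDecay (latOrder d + 1) X₂ (c₂ t))
    {lam D : ℝ} (hlam : 1 ≤ lam) (hD : 0 ≤ D)
    (hdiff : ∀ t, HasDecay (K + 1) (D * Real.exp (lam * clamp T t)) (fun m => c₁ t m - c₂ t m))
    (t : ℝ) :
    HasDecay (K + 1) (Fintype.card d * (2 ^ K * latMass d * (2 * π * (A + A₀))) *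
        ((1 + 1 / (2 * Real.sqrt (4 * π ^ 2 * κ))) / Real.sqrt lam) * D *
          Real.exp (lam * clamp T t))
      (fun k => picardMap κ T U S a c₁ t k - picardMap κ T U S a c₂ t k) := by
  intro k
  have hτ := FourierNS.clamp_mem_Icc h.hT.le t
  set τ := clamp T t with hτdef
  -- the two transport symbols and integrands
  set N₁ : ℝ → ℂ := fun s => transportSym (fun j => U j s) (c₁ s) k with hN₁
  set N₂ : ℝ → ℂ := fun s => transportSym (fun j => U j s) (c₂ s) k with hN₂
  set F₁ : ℝ → ℂ := fun s => (heatFactor κ k (τ - s) : ℂ) * (S s k - N₁ s) with hF₁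
  set F₂ : ℝ → ℂ := fun s => (heatFactor κ k (τ - s) : ℂ) * (S s k - N₂ s) with hF₂
  have hF₁c : Continuous F₁ := h.continuous_integrand hc₁ hd₁ k τ
  have hF₂c : Continuous F₂ := h.continuous_integrand hc₂ hd₂ k τ
  -- the difference of the two Duhamel maps
  have hdiffeq : picardMap κ T U S a c₁ t k - picardMap κ T U S a c₂ t k =
      ∫ s in (0:ℝ)..τ, (heatFactor κ k (τ - s) : ℂ) * (N₂ s - N₁ s) := by
    change (heatFactor κ k τ : ℂ) * a k + (∫ s in (0:ℝ)..τ, F₁ s) -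
      ((heatFactor κ k τ : ℂ) * a k + ∫ s in (0:ℝ)..τ, F₂ s) = _
    rw [add_sub_add_left_eq_sub, ← intervalIntegral.integral_sub (hF₁c.intervalIntegrable _ _)
      (hF₂c.intervalIntegrable _ _)]
    refine intervalIntegral.integral_congr fun s _ => ?_
    simp only [hF₁, hF₂]
    ring
  -- the difference of the transport symbols is the transport symbol of the difference
  set C := Fintype.card d * (2 ^ K * latMass d * (2 * π * (A + A₀))) with hC
  have hC0 : 0 ≤ C := transportConst_nonneg K hA₀ hA
  have hNbound : ∀ s ∈ Icc 0 τ, ‖N₂ s - N₁ s‖ ≤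
      C * D * ((1 + ‖k‖) ^ K)⁻¹ * Real.exp (lam * s) := by
    intro s hs
    have hsT : s ∈ Icc 0 T := ⟨hs.1, hs.2.trans hτ.2⟩
    have hδ : HasDecay (K + 1) (D * Real.exp (lam * s)) (fun m => c₂ s m - c₁ s m) := by
      intro m
      have h1 := (hdiff s) m
      rw [FourierNS.clamp_of_mem hsT] at h1
      rwa [norm_sub_rev] at h1
    have hδ₀ : HasDecay (latOrder d + 1) (D * Real.exp (lam * s)) (fun m => c₂ s m - c₁ s m) :=
      hδ.of_le (by omega)
    have hDs : 0 ≤ D * Real.exp (lam * s) := by positivity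
    have hN := hasDecay_transportSym (fun j => hU₀ j s) (fun j => hUK j s) hA hδ₀ hδ hDs k
    have hsub := transportSym_sub (fun j => hU₀ j s) (hd₂ s) (hd₁ s) k
    calc ‖N₂ s - N₁ s‖ = ‖transportSym (fun j => U j s) (fun m => c₂ s m - c₁ s m) k‖ := by
          rw [hN₂, hN₁, hsub]
      _ ≤ _ := hN
      _ = C * D * ((1 + ‖k‖) ^ K)⁻¹ * Real.exp (lam * s) := by simp only [hC]; ring
  -- Duhamel bound and heat gain
  have hI := norm_duhamel_le κ hτ.1 (F := fun s => N₂ s - N₁ s)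
    (M := C * D * ((1 + ‖k‖) ^ K)⁻¹) (lam := lam) hNbound k
  have hgain := heat_weight_gain h.hκ hlam k hτ.1
  have hw : ((1 + ‖k‖) ^ K)⁻¹ = (1 + ‖k‖) * ((1 + ‖k‖) ^ (K + 1))⁻¹ := by
    have : (0:ℝ) < 1 + ‖k‖ := by positivity
    rw [pow_succ]
    field_simp
  change ‖picardMap κ T U S a c₁ t k - picardMap κ T U S a c₂ t k‖ ≤ _
  rw [hdiffeq]
  calc ‖∫ s in (0:ℝ)..τ, (heatFactor κ k (τ - s) : ℂ) * (N₂ s - N₁ s)‖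
      ≤ C * D * ((1 + ‖k‖) ^ K)⁻¹ *
          ∫ s in (0:ℝ)..τ, Real.exp (-(heatRate κ k) * (τ - s)) * Real.exp (lam * s) := hI
    _ = C * D * ((1 + ‖k‖) ^ (K + 1))⁻¹ * ((1 + ‖k‖) *
          ∫ s in (0:ℝ)..τ, Real.exp (-(heatRate κ k) * (τ - s)) * Real.exp (lam * s)) := by
        rw [hw]; ring
    _ ≤ C * D * ((1 + ‖k‖) ^ (K + 1))⁻¹ *
          (Real.exp (lam * τ) * ((1 + 1 / (2 * Real.sqrt (4 * π ^ 2 * κ))) / Real.sqrt lam)) :=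
        mul_le_mul_of_nonneg_left hgain (by positivity)
    _ = C * ((1 + 1 / (2 * Real.sqrt (4 * π ^ 2 * κ))) / Real.sqrt lam) * D *
          Real.exp (lam * τ) * ((1 + ‖k‖) ^ (K + 1))⁻¹ := by ring

end Contraction

/-! ### The iteration: geometric convergence, the limit and the fixed point -/

section Iteration

variable [DecidableEq d]
variable {κ T : ℝ} {U : d → ℝ → (d → ℤ) → ℂ} {S : ℝ → (d → ℤ) → ℂ} {a : (d → ℤ) → ℂ}

/-- **Choice of the time weight.** For every order `K ≥ 2#d` there is `λ ≥ 1` such that the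
Duhamel map contracts weighted differences of order `K + 1` by the factor `1/2`:
if `‖c₁(t) - c₂(t)‖ ≤ D e^{λ clamp t}(1+‖·‖)^{-(K+1)}` then
`‖Φc₁(t) - Φc₂(t)‖ ≤ ½ D e^{λ clamp t}(1+‖·‖)^{-(K+1)}` (take `λ = (2 C_K E(κ))² + 1` in
`hasDecay_picardMap_sub`). [folklore] -/
theorem PicardHyp.exists_contraction (h : PicardHyp κ T U S a) {K : ℕ} (hK : latOrder d ≤ K) :
    ∃ lam : ℝ, 1 ≤ lam ∧ ∀ (c₁ c₂ : ℝ → (d → ℤ) → ℂ) (X₁ X₂ D : ℝ),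
      (∀ m, Continuous fun t => c₁ t m) → (∀ m, Continuous fun t => c₂ t m) →
      (∀ t, HasDecay (latOrder d + 1) X₁ (c₁ t)) → (∀ t, HasDecay (latOrder d + 1) X₂ (c₂ t)) →
      0 ≤ D →
      (∀ t, HasDecay (K + 1) (D * Real.exp (lam * clamp T t)) (fun m => c₁ t m - c₂ t m)) →
      ∀ t, HasDecay (K + 1) (1 / 2 * D * Real.exp (lam * clamp T t))
        (fun k => picardMap κ T U S a c₁ t k - picardMap κ T U S a c₂ t k) := by
  obtain ⟨A₀, hA₀, hU₀⟩ := h.decayU_nonneg (latOrder d)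
  obtain ⟨A, hA, hUK⟩ := h.decayU_nonneg K
  set L := Fintype.card d * (2 ^ K * latMass d * (2 * π * (A + A₀))) *
    (1 + 1 / (2 * Real.sqrt (4 * π ^ 2 * κ))) with hL
  have hL0 : 0 ≤ L := by
    have := transportConst_nonneg (d := d) K hA₀ hA
    positivity
  refine ⟨(2 * L) ^ 2 + 1, by nlinarith, ?_⟩
  intro c₁ c₂ X₁ X₂ D hc₁ hc₂ hd₁ hd₂ hD hdiff t
  have hlam : (1 : ℝ) ≤ (2 * L) ^ 2 + 1 := by nlinarith
  have key := h.hasDecay_picardMap_sub hK hA₀ hA hU₀ hUK hc₁ hc₂ hd₁ hd₂ hlam hD hdiff t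
  refine key.mono ?_
  have hsq : 2 * L ≤ Real.sqrt ((2 * L) ^ 2 + 1) := by
    calc 2 * L = Real.sqrt ((2 * L) ^ 2) := (Real.sqrt_sq (by positivity)).symm
      _ ≤ Real.sqrt ((2 * L) ^ 2 + 1) := Real.sqrt_le_sqrt (by linarith)
  have hspos : 0 < Real.sqrt ((2 * L) ^ 2 + 1) := Real.sqrt_pos.2 (by positivity)
  have hfac : Fintype.card d * (2 ^ K * latMass d * (2 * π * (A + A₀))) *
      ((1 + 1 / (2 * Real.sqrt (4 * π ^ 2 * κ))) / Real.sqrt ((2 * L) ^ 2 + 1)) ≤ 1 / 2 := by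
    rw [mul_div_assoc', ← hL, div_le_iff₀ hspos]
    linarith
  have hE : 0 ≤ D * Real.exp (((2 * L) ^ 2 + 1) * clamp T t) := by positivity
  calc _ = Fintype.card d * (2 ^ K * latMass d * (2 * π * (A + A₀))) *
        ((1 + 1 / (2 * Real.sqrt (4 * π ^ 2 * κ))) / Real.sqrt ((2 * L) ^ 2 + 1)) *
        (D * Real.exp (((2 * L) ^ 2 + 1) * clamp T t)) := by ring
    _ ≤ 1 / 2 * (D * Real.exp (((2 * L) ^ 2 + 1) * clamp T t)) :=
        mul_le_mul_of_nonneg_right hfac hE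
    _ = _ := by ring

/-- `e^{λ clamp t} ≤ e^{λ T}` for `λ ≥ 0`, `T ≥ 0`. [folklore] -/
theorem exp_clamp_le {lam : ℝ} (hlam : 0 ≤ lam) (hT : 0 ≤ T) (t : ℝ) :
    Real.exp (lam * clamp T t) ≤ Real.exp (lam * T) :=
  Real.exp_le_exp.2 (mul_le_mul_of_nonneg_left (FourierNS.clamp_le hT t) hlam)

/-- `1 ≤ e^{λ clamp t}` for `λ ≥ 0`. [folklore] -/
theorem one_le_exp_clamp {lam : ℝ} (hlam : 0 ≤ lam) (t : ℝ) : 1 ≤ Real.exp (lam * clamp T t) :=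
  Real.one_le_exp (mul_nonneg hlam (FourierNS.clamp_nonneg T t))

omit [DecidableEq d] in
/-- **The iteration estimates.** With `λ` from `exists_contraction` and `D` an order-`K+1`
constant of the first iterate `c₁ = Φ(0)`, for every `n`: `cₙ` is continuous in time at each
frequency, `‖cₙ₊₁(t) - cₙ(t)‖ ≤ D 2^{-n} e^{λ clamp t} (1+‖·‖)^{-(K+1)}` and
`‖cₙ(t)‖ ≤ 2D(1 - 2^{-n}) e^{λT} (1+‖·‖)^{-(K+1)}` (induction on `n`; Picard's successive
approximations, cf. Leray 1934, §19, for the Navier–Stokes twin). [folklore] -/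
theorem PicardHyp.iter_estimates (h : PicardHyp κ T U S a) {K : ℕ} (hK : latOrder d ≤ K)
    {lam : ℝ} (hlam : 1 ≤ lam)
    (hcontr : ∀ (c₁ c₂ : ℝ → (d → ℤ) → ℂ) (X₁ X₂ D : ℝ),
      (∀ m, Continuous fun t => c₁ t m) → (∀ m, Continuous fun t => c₂ t m) →
      (∀ t, HasDecay (latOrder d + 1) X₁ (c₁ t)) → (∀ t, HasDecay (latOrder d + 1) X₂ (c₂ t)) →
      0 ≤ D →
      (∀ t, HasDecay (K + 1) (D * Real.exp (lam * clamp T t)) (fun m => c₁ t m - c₂ t m)) →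
      ∀ t, HasDecay (K + 1) (1 / 2 * D * Real.exp (lam * clamp T t))
        (fun k => picardMap κ T U S a c₁ t k - picardMap κ T U S a c₂ t k))
    {D : ℝ} (hD : 0 ≤ D) (hbase : ∀ t, HasDecay (K + 1) D (picardMap κ T U S a (fun _ _ => 0) t))
    (n : ℕ) :
    (∀ m, Continuous fun t => picardIter κ T U S a n t m) ∧
    (∀ t, HasDecay (K + 1) (D * (1 / 2) ^ n * Real.exp (lam * clamp T t))
      (fun m => picardIter κ T U S a (n + 1) t m - picardIter κ T U S a n t m)) ∧
    (∀ t, HasDecay (K + 1) (2 * D * (1 - (1 / 2) ^ n) * Real.exp (lam * T))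
      (picardIter κ T U S a n t)) := by
  have hlam0 : 0 ≤ lam := by linarith
  have hK1 : latOrder d + 1 ≤ K + 1 := by omega
  induction n with
  | zero =>
    refine ⟨fun m => ?_, fun t => ?_, fun t => ?_⟩
    · simpa using continuous_const
    · intro m
      have h1 := hbase t m
      simp only [picardIter_succ, picardIter_zero, sub_zero, pow_zero, mul_one]
      exact h1.trans (mul_le_mul_of_nonneg_right
        (le_mul_of_one_le_right hD (one_le_exp_clamp hlam0 t)) (by positivity))
    · intro m
      simp
  | succ n ih =>
    obtain ⟨hcont, hdiff, hbound⟩ := ih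
    -- (iii) at `n + 1`
    have hbound' : ∀ t, HasDecay (K + 1) (2 * D * (1 - (1 / 2) ^ (n + 1)) * Real.exp (lam * T))
        (picardIter κ T U S a (n + 1) t) := by
      intro t m
      have h1 := hbound t m
      have h2 := hdiff t m
      have hexp := exp_clamp_le (T := T) hlam0 h.hT.le t
      calc ‖picardIter κ T U S a (n + 1) t m‖ ≤ ‖picardIter κ T U S a n t m‖ +
            ‖picardIter κ T U S a (n + 1) t m - picardIter κ T U S a n t m‖ := norm_le_insert' _ _
        _ ≤ 2 * D * (1 - (1 / 2) ^ n) * Real.exp (lam * T) * ((1 + ‖m‖) ^ (K + 1))⁻¹ +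
            D * (1 / 2) ^ n * Real.exp (lam * clamp T t) * ((1 + ‖m‖) ^ (K + 1))⁻¹ :=
          add_le_add h1 h2
        _ ≤ 2 * D * (1 - (1 / 2) ^ n) * Real.exp (lam * T) * ((1 + ‖m‖) ^ (K + 1))⁻¹ +
            D * (1 / 2) ^ n * Real.exp (lam * T) * ((1 + ‖m‖) ^ (K + 1))⁻¹ := by gcongr
        _ = 2 * D * (1 - (1 / 2) ^ (n + 1)) * Real.exp (lam * T) * ((1 + ‖m‖) ^ (K + 1))⁻¹ := by
          ring
    -- (i) at `n + 1`
    have hcont' : ∀ m, Continuous fun t => picardIter κ T U S a (n + 1) t m := fun m => by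
      simp only [picardIter_succ]
      exact h.continuous_picardMap hcont (fun t => (hbound t).of_le hK1) m
    -- (ii) at `n + 1`
    refine ⟨hcont', fun t => ?_, hbound'⟩
    have key := hcontr (picardIter κ T U S a (n + 1)) (picardIter κ T U S a n) _ _
      (D * (1 / 2) ^ n) hcont' hcont (fun t => (hbound' t).of_le hK1)
      (fun t => (hbound t).of_le hK1) (by positivity) hdiff t
    simp only [picardIter_succ] at key ⊢
    convert key using 2
    ring

/-- **Convergence of the Picard iteration with all estimates.** For every order `K ≥ 2#d`
there are `R ≥ 0` and the weight `λ ≥ 1` of `exists_contraction` such that all iterates are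
continuous in time, `‖cₙ(t)‖ ≤ R (1+‖·‖)^{-(K+1)}`, and `cₙ → c = picardLim` with
`‖cₙ(t) - c(t)‖ ≤ R 2^{-n} (1+‖·‖)^{-(K+1)}` uniformly in `t` (geometric series;
Mathlib `cauchySeq_of_le_geometric`, `dist_le_of_le_geometric_of_tendsto`). [folklore] -/
theorem PicardHyp.iter_tendsto (h : PicardHyp κ T U S a) {K : ℕ} (hK : latOrder d ≤ K) :
    ∃ R lam : ℝ, 0 ≤ R ∧ 1 ≤ lam ∧
      (∀ (c₁ c₂ : ℝ → (d → ℤ) → ℂ) (X₁ X₂ D : ℝ),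
        (∀ m, Continuous fun t => c₁ t m) → (∀ m, Continuous fun t => c₂ t m) →
        (∀ t, HasDecay (latOrder d + 1) X₁ (c₁ t)) → (∀ t, HasDecay (latOrder d + 1) X₂ (c₂ t)) →
        0 ≤ D →
        (∀ t, HasDecay (K + 1) (D * Real.exp (lam * clamp T t)) (fun m => c₁ t m - c₂ t m)) →
        ∀ t, HasDecay (K + 1) (1 / 2 * D * Real.exp (lam * clamp T t))
          (fun k => picardMap κ T U S a c₁ t k - picardMap κ T U S a c₂ t k)) ∧
      (∀ n m, Continuous fun t => picardIter κ T U S a n t m) ∧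
      (∀ n t, HasDecay (K + 1) R (picardIter κ T U S a n t)) ∧
      (∀ t m, Tendsto (fun n => picardIter κ T U S a n t m) atTop (𝓝 (picardLim κ T U S a t m))) ∧
      (∀ n t, HasDecay (K + 1) (R * (1 / 2) ^ n)
        (fun m => picardIter κ T U S a n t m - picardLim κ T U S a t m)) := by
  obtain ⟨lam, hlam, hcontr⟩ := h.exists_contraction hK
  obtain ⟨Aₐ, hAₐ, ha⟩ := h.decayA_nonneg (K + 1)
  obtain ⟨B, hB, hS⟩ := h.decayS_nonneg (K + 1)
  have hD : 0 ≤ Aₐ + T * B := by have := h.hT.le; positivity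
  have hbase := h.hasDecay_picardMap_zero ha hS
  have hest := h.iter_estimates hK hlam hcontr hD hbase
  have hlam0 : 0 ≤ lam := by linarith
  set D := Aₐ + T * B with hDdef
  set R := 2 * D * Real.exp (lam * T) with hR
  have hR0 : 0 ≤ R := by positivity
  -- the geometric bound on consecutive differences, uniformly in `t`
  have hstep : ∀ t m n, dist (picardIter κ T U S a n t m) (picardIter κ T U S a (n + 1) t m) ≤
      D * Real.exp (lam * T) * ((1 + ‖m‖) ^ (K + 1))⁻¹ * (1 / 2) ^ n := by
    intro t m n
    rw [dist_eq_norm, norm_sub_rev]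
    have h1 := (hest n).2.1 t m
    have hexp := exp_clamp_le (T := T) hlam0 h.hT.le t
    calc _ ≤ D * (1 / 2) ^ n * Real.exp (lam * clamp T t) * ((1 + ‖m‖) ^ (K + 1))⁻¹ := h1
      _ ≤ D * (1 / 2) ^ n * Real.exp (lam * T) * ((1 + ‖m‖) ^ (K + 1))⁻¹ := by gcongr
      _ = _ := by ring
  have hcauchy : ∀ t m, CauchySeq fun n => picardIter κ T U S a n t m := fun t m =>
    cauchySeq_of_le_geometric (1 / 2) _ (by norm_num) (hstep t m)
  have htend : ∀ t m, Tendsto (fun n => picardIter κ T U S a n t m) atTop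
      (𝓝 (picardLim κ T U S a t m)) := fun t m => (hcauchy t m).tendsto_limUnder
  have herr : ∀ n t m, ‖picardIter κ T U S a n t m - picardLim κ T U S a t m‖ ≤
      R * (1 / 2) ^ n * ((1 + ‖m‖) ^ (K + 1))⁻¹ := by
    intro n t m
    have h1 := dist_le_of_le_geometric_of_tendsto (1 / 2) _ (by norm_num) (hstep t m) (htend t m) n
    rw [dist_eq_norm] at h1
    refine h1.trans_eq ?_
    simp only [hR]
    ring
  refine ⟨R, lam, hR0, hlam, hcontr, fun n => (hest n).1, fun n t m => ?_, htend, fun n t m => herr n t m⟩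
  have h1 := (hest n).2.2 t m
  refine h1.trans (mul_le_mul_of_nonneg_right ?_ (by positivity))
  simp only [hR]
  have : (0:ℝ) ≤ (1 / 2) ^ n := by positivity
  nlinarith [Real.exp_pos (lam * T)]

/-- The Picard limit is continuous in time at each frequency (uniform limit of continuous
functions, Mathlib `TendstoUniformly.continuous`). [folklore] -/
theorem PicardHyp.continuous_picardLim (h : PicardHyp κ T U S a) (m : d → ℤ) :
    Continuous fun t => picardLim κ T U S a t m := by
  obtain ⟨R, lam, hR0, -, -, hcont, -, -, herr⟩ := h.iter_tendsto le_rfl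
  have hunif : TendstoUniformly (fun n t => picardIter κ T U S a n t m)
      (fun t => picardLim κ T U S a t m) atTop := by
    refine Metric.tendstoUniformly_iff.2 fun ε hε => ?_
    have hgeo : Tendsto (fun n : ℕ => R * (1 / 2 : ℝ) ^ n) atTop (𝓝 0) := by
      have := tendsto_pow_atTop_nhds_zero_of_lt_one (r := (1 / 2 : ℝ)) (by norm_num) (by norm_num)
      simpa using this.const_mul R
    filter_upwards [(tendsto_order.1 hgeo).2 ε hε] with n hn t
    rw [dist_comm, dist_eq_norm]
    have h1 := herr n t m
    have hw : ((1 + ‖m‖) ^ (latOrder d + 1))⁻¹ ≤ 1 := FourierNS.inv_one_add_norm_pow_le_one m _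
    calc _ ≤ R * (1 / 2) ^ n * ((1 + ‖m‖) ^ (latOrder d + 1))⁻¹ := h1
      _ ≤ R * (1 / 2) ^ n * 1 := by gcongr
      _ < ε := by rw [mul_one]; exact hn
  exact hunif.continuous (Frequently.of_forall fun n => hcont n m)

/-- **Every polynomial decay of the Picard limit**, uniformly in time. [folklore] -/
theorem PicardHyp.hasDecay_picardLim (h : PicardHyp κ T U S a) (K : ℕ) :
    ∃ C : ℝ, 0 ≤ C ∧ ∀ t, HasDecay K C (picardLim κ T U S a t) := by
  obtain ⟨R, lam, hR0, -, -, -, -, -, herr⟩ := h.iter_tendsto (le_max_left (latOrder d) K)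
  refine ⟨R, hR0, fun t m => ?_⟩
  have h1 := herr 0 t m
  simp only [picardIter_zero, zero_sub, norm_neg, pow_zero, mul_one] at h1
  exact h1.trans (mul_le_mul_of_nonneg_left
    (FourierNS.inv_one_add_norm_pow_anti m (by omega)) hR0)

/-- **The Picard limit is a fixed point of the Duhamel map**: `c = Φ(c)`, i.e. the mild
equation `c(t,k) = e^{-νₖτ} a(k) + ∫₀^τ e^{-νₖ(τ-s)} (S(s,k) - N(U(s), c(s))(k)) ds`,
`τ = clamp T t`. [folklore] -/
theorem PicardHyp.picardLim_eq_picardMap (h : PicardHyp κ T U S a) (t : ℝ) (k : d → ℤ) :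
    picardLim κ T U S a t k = picardMap κ T U S a (picardLim κ T U S a) t k := by
  obtain ⟨R, lam, hR0, hlam, hcontr, hcont, hdec, -, herr⟩ := h.iter_tendsto le_rfl
  have hlam0 : 0 ≤ lam := by linarith
  set c := picardLim κ T U S a with hc
  have hcc : ∀ m, Continuous fun t => c t m := h.continuous_picardLim
  have hcd : ∀ t, HasDecay (latOrder d + 1) R (c t) := fun t m => by
    have h1 := herr 0 t m
    simpa [picardIter_zero] using h1
  -- `‖Φc - c‖ ≤ ½ R 2^{-n} e^{λ clamp t} w + R 2^{-(n+1)} w` for every `n`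
  have hbound : ∀ n : ℕ, ‖picardMap κ T U S a c t k - c t k‖ ≤
      (1 / 2 * (R * (1 / 2) ^ n) * Real.exp (lam * clamp T t) + R * (1 / 2) ^ (n + 1)) *
        ((1 + ‖k‖) ^ (latOrder d + 1))⁻¹ := by
    intro n
    have hdiff : ∀ t, HasDecay (latOrder d + 1) (R * (1 / 2) ^ n * Real.exp (lam * clamp T t))
        (fun m => c t m - picardIter κ T U S a n t m) := by
      intro t m
      have h1 := herr n t m
      rw [norm_sub_rev] at h1
      exact h1.trans (mul_le_mul_of_nonneg_right
        (le_mul_of_one_le_right (by positivity) (one_le_exp_clamp hlam0 t)) (by positivity))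
    have key := hcontr c (picardIter κ T U S a n) R R (R * (1 / 2) ^ n) hcc (hcont n) hcd
      (fun t => hdec n t) (by positivity) hdiff t k
    rw [← picardIter_succ] at key
    have h2 := herr (n + 1) t k
    calc ‖picardMap κ T U S a c t k - c t k‖
        ≤ ‖picardMap κ T U S a c t k - picardIter κ T U S a (n + 1) t k‖ +
          ‖picardIter κ T U S a (n + 1) t k - c t k‖ := norm_sub_le_norm_sub_add_norm_sub _ _ _
      _ ≤ _ := add_le_add key h2
      _ = _ := by ring
  have hlim : Tendsto (fun n : ℕ => (1 / 2 * (R * (1 / 2) ^ n) * Real.exp (lam * clamp T t) +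
      R * (1 / 2) ^ (n + 1)) * ((1 + ‖k‖) ^ (latOrder d + 1))⁻¹) atTop (𝓝 0) := by
    have hg := tendsto_pow_atTop_nhds_zero_of_lt_one (r := (1 / 2 : ℝ)) (by norm_num) (by norm_num)
    have h1 : Tendsto (fun n : ℕ => (1 / 2 * (R * (1 / 2 : ℝ) ^ n) * Real.exp (lam * clamp T t) +
        R * (1 / 2) ^ (n + 1))) atTop (𝓝 0) := by
      have e1 := (hg.const_mul R).const_mul (1 / 2 : ℝ)
      have e2 := e1.mul_const (Real.exp (lam * clamp T t))
      have e3 := (hg.comp (tendsto_add_atTop_nat 1)).const_mul R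
      simp only [mul_zero, zero_mul] at e2 e3
      have := e2.add e3
      simp only [add_zero] at this
      refine this.congr fun n => ?_
      simp only [Function.comp_apply]
    simpa using h1.mul_const (((1 + ‖k‖) ^ (latOrder d + 1))⁻¹)
  have h0 : ‖picardMap κ T U S a c t k - c t k‖ ≤ 0 :=
    ge_of_tendsto' hlim fun n => hbound n
  have := norm_le_zero_iff.1 h0
  rw [sub_eq_zero] at this
  exact this.symm

omit [DecidableEq d] in
/-- The Duhamel map at time `0` returns the datum: `Φ(c)(0, k) = a(k)`. [folklore] -/
theorem picardMap_zero_time (hT : 0 ≤ T) (c : ℝ → (d → ℤ) → ℂ) (k : d → ℤ) :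
    picardMap κ T U S a c 0 k = a k := by
  simp [picardMap, FourierNS.clamp_zero hT]

/-- **The Picard limit attains the datum**: `c(0, k) = a(k)`. [folklore] -/
theorem PicardHyp.picardLim_zero (h : PicardHyp κ T U S a) (k : d → ℤ) :
    picardLim κ T U S a 0 k = a k := by
  rw [h.picardLim_eq_picardMap 0 k, picardMap_zero_time h.hT.le]

end Iteration

end ScalarFourier

end Literature.Analysis.FluidPDE

end
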